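import Literature.GroupTheory.CombinatorialGroupTheory.FibredTranslationCocycles
import HarnessLib

/-!
# Peeling a middle and the last factor off an ordered `List.finRange` product

Topic `Literature/GroupTheory/CombinatorialGroupTheory`; PROOF-ONLY (0 definitions).  A non-commutative bookkeeping
lemma for products over `List.finRange n` padded by `1` (sequel to `prod_map_finRange_split`,
`prod_map_finRange_eq_first_mul_mid_mul_last`): `∏_{i<n} F i = (∏_{i<m} F i) · F m · (∏_{m<i<n−1} F i) · F (n−1)` for
`m + 1 < n` — used to evaluate the one relator of `Γ_{g,r}` when the twisted handle sits in the middle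
(`PuncturedSurfaceGroupLoopTwistAt.lean`; [CombGC] Prop. 1.2 proof p. 9 [cite: MochizukiCombGC2007, Prop 1.2 proof p.9]).
-/

namespace Literature.GroupTheory.CombinatorialGroupTheory

/-! ### Peeling a middle and the last factor off an ordered `List.finRange` product -/

section Lists

variable {P : Type*} [Monoid P]

/-- **Front · at `m` · middle · last**: for `m + 1 < n`,
`∏_{i<n} F i = (∏_{i<m} F i) · F m · (∏_{m<i<n−1} F i) · F (n−1)` (padded products).
[cite: LyndonSchupp2001, I.3 Prop 3.8] -/
theorem prod_map_finRange_eq_front_mul_at_mul_mid_mul_last {n m : ℕ} (hm : m + 1 < n) (F : Fin n → P) :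
    ((List.finRange n).map F).prod =
      ((List.finRange n).map fun i : Fin n => if (i : ℕ) < m then F i else 1).prod * F ⟨m, by omega⟩ *
        ((List.finRange n).map fun i : Fin n =>
          if m < (i : ℕ) then (if (i : ℕ) < n - 1 then F i else 1) else 1).prod * F ⟨n - 1, by omega⟩ := by
  rw [prod_map_finRange_split n m F, mul_assoc, mul_assoc]
  congr 1
  -- the tail `∏_{m ≤ i} F i = F m · ∏_{m < i}`
  rw [prod_map_finRange_split n (m + 1) (fun i : Fin n => if m ≤ (i : ℕ) then F i else 1)]
  have h1 : ((List.finRange n).map fun i : Fin n =>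
      if (i : ℕ) < m + 1 then (if m ≤ (i : ℕ) then F i else 1) else 1).prod = F ⟨m, by omega⟩ := by
    rw [← prod_map_finRange_ite_eq ⟨m, by omega⟩ F]
    refine congrArg List.prod (List.map_congr_left fun i _ => ?_)
    by_cases hi : i = ⟨m, by omega⟩
    · subst hi; simp
    · have hi' : (i : ℕ) ≠ m := fun h => hi (Fin.ext h)
      by_cases h2 : (i : ℕ) < m + 1
      · rw [if_pos h2, if_neg (by omega), if_neg hi]
      · rw [if_neg h2, if_neg hi]
  rw [h1]
  congr 1
  -- the tail `∏_{m < i} F i = (∏_{m<i<n-1} F i) · F (n-1)`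
  have h2 : ((List.finRange n).map fun i : Fin n =>
      if m + 1 ≤ (i : ℕ) then (if m ≤ (i : ℕ) then F i else 1) else 1).prod =
      ((List.finRange n).map fun i : Fin n => if m < (i : ℕ) then F i else 1).prod :=
    congrArg List.prod (List.map_congr_left fun i _ => by
      by_cases h : m < (i : ℕ)
      · rw [if_pos (by omega), if_pos (by omega), if_pos h]
      · rw [if_neg (by omega), if_neg h])
  rw [h2, prod_map_finRange_split n (n - 1) (fun i : Fin n => if m < (i : ℕ) then F i else 1)]
  congr 1
  · refine congrArg List.prod (List.map_congr_left fun i _ => ?_)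
    by_cases h : (i : ℕ) < n - 1
    · rw [if_pos h]
      by_cases h' : m < (i : ℕ)
      · rw [if_pos h', if_pos h', if_pos h]
      · rw [if_neg h', if_neg h']
    · rw [if_neg h]
      by_cases h' : m < (i : ℕ)
      · rw [if_pos h', if_neg h]
      · rw [if_neg h']
  · rw [← prod_map_finRange_ite_eq ⟨n - 1, by omega⟩ F]
    refine congrArg List.prod (List.map_congr_left fun i _ => ?_)
    by_cases hi : i = ⟨n - 1, by omega⟩
    · subst hi; rw [if_pos (le_refl _), if_pos (show m < n - 1 by omega), if_pos rfl]
    · have hi' : ¬ n - 1 ≤ (i : ℕ) := fun h => hi (Fin.ext (by have := i.isLt; simp; omega))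
      rw [if_neg hi', if_neg hi]

end Lists

end Literature.GroupTheory.CombinatorialGroupTheory
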